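import Mathlib
import HarnessLib
import Literature.Probability.RandomPlanarGeometry.BlobTimeDomainLaw
import Summits.CriticalPhenomena.SAWScalingLimit.Statement
import Summits.CriticalPhenomena.SAWScalingLimit.Theses.SAWCutPointCondensation

/-!
# Line `birth` — registered skeleton for the crux `SAWCutPointCondensation.PenaltyUniversality`

Crux item stmt-CriticalPhenomena-7348 (rank 4 of `route-CriticalPhenomena-SAWCutPointCondensation`,
sub-problem `CriticalPhenomena/SAWScalingLimit`).  Skeleton registrar
`planner-skel-stmt-CriticalPhenomena-7348-0`, 2026-08-17 (BC3 birth certificate).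

## The crux (FIXED; concluded BY NAME by `PenaltyUniversality_of`)

For every Dobrushin domain `(D; a, b)`, endpoint approximation `(a_δ, b_δ)` and two blob-fugacity
schedules `t₁ t₂ : ℝ → ℝ` with, eventually along `δ → 0⁺`, `tᵢ δ ∈ [0, 1]` and, for every `M`,
eventually `tᵢ δ ≤ exp (-M δ^{3/4})` (the effective window coupling diverges), the critical blob-time
laws `BL_{t₁ δ}` and `BL_{t₂ δ}` of `(Ω_δ; a_δ, b_δ)` are asymptotically equal in law:
`∫ f dBL_{t₁ δ} - ∫ f dBL_{t₂ δ} → 0` for every bounded continuous `f` on `CurveClass ℂ`.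
The inlined law of the item is, by `rfl` (`BlobTime.domainLaw_eq`), the named law
`Literature.Probability.RandomPlanarGeometry.BlobTime.domainLaw t Ω δ a b` (file
`Literature/Probability/RandomPlanarGeometry/BlobTimeDomainLaw.lean`); the stubs are stated over it.

## The line: REGIME SPLIT of the fugacity axis `[0, 1)` (the route's foreseen glued split
"PenaltyUniversality ⇐ FixedFugacityUniversality → ScheduleComparison", made exact)

Write `Φ_δ(t) := ∫ f dBL_t(Ω_δ; a_δ, b_δ)`.  The crux is (classically) EQUIVALENT to the uniform
statement `U : ∀ ε ∃ M, ∀ᶠ δ, ∀ t ∈ [0, exp (-M δ^{3/4})], |Φ_δ(t) - Φ_δ(0)| < ε` (a diagonal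
schedule extracts a counterexample), and `U` is cut at a fixed fugacity `t₀ < 1` into two regimes with
DIFFERENT physics:

* `stub_fixedFugacityUniversality` (the SAW end; "any fixed positive price per unit of blob time flows
  to the self-avoiding walk", uniformly on compact fugacity ranges): for every `t₀ < 1` and `ε > 0`,
  eventually along `δ → 0⁺`, `|Φ_δ(t) - Φ_δ(0)| < ε` for all `t ∈ [0, t₀]`.  At fixed `t ∈ (0, 1)` the
  `BL_t`-typical walk carries a positive DENSITY of microscopic blobs (total-variation distance to the
  SAW → 1), so this is a perturbative universality statement about the SAW fixed point (the blob
  fugacity is irrelevant there), of Domb–Joyce type [BDGS2012 §1.5, MadrasSlade1993 §10.1]; open.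
* `stub_windowPlateau` (the near-Brownian end; "slowly closing windows behave like SOME fixed
  fugacity"): for every `ε > 0` there are `t₀ ∈ [0, 1)` and `M` such that, eventually along `δ → 0⁺`,
  `|Φ_δ(t) - Φ_δ(t₀)| < ε` for all `t ∈ [t₀, exp (-M δ^{3/4})]`.  Content: across the whole plateau
  the crossover length `δ (-log t)^{-4/3}` stays below the macroscopic scale `M^{-4/3}`, above which
  all these laws agree (relevance eigenvalue `y = 3/4 = 2 - ξ(1,1)`,
  [LawlerSchrammWerner2001PlaneExponents, Lawler1996CutTimes, GaoLiPanovShiraishi2026]); says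
  NOTHING about the SAW (`t = 0`).

Composition (`tendsto_sub_of_regimes`, kernel-checked, sorry-free): given an admissible schedule `t`
and `ε`, take `t₀, M` from the plateau stub at `ε/2`, the fixed-fugacity stub on `[0, t₀]` at `ε/2`,
and split each small `δ` according to `t δ ≤ t₀` (one estimate) or `t₀ < t δ ≤ exp (-M δ^{3/4})`
(plateau to `t₀`, then `t₀` to `0`: triangle inequality); so `Φ_δ(t δ) - Φ_δ(0) → 0` for every
admissible schedule, and the crux is the difference of two such limits.  Both stubs are CONSEQUENCES
of the crux (via `U`), so the split loses nothing; neither implies the crux alone (the first is silent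
on schedules `t δ → 1`, the second on `t = 0`).

Disproof used: none relevant (no `Cruxes/PenaltyUniversality/Disproof.lean` exists at registration;
negatives index of the summit, 11 entries, has no blob-time statement; the only tightness-type negative,
stmt-CriticalPhenomena-0772 "for all meshes", is avoided: every mesh quantifier here is `∀ᶠ δ in 𝓝[>] 0`).
-/

noncomputable section

namespace Summit.CriticalPhenomena.SAWScalingLimit.Cruxes.PenaltyUniversality.Birth

open Filter Set MeasureTheory
open scoped Topology
open Literature.Probability.RandomPlanarGeometry Literature.Probability.LatticeModels

/-! ### The two pieces, as named statements

(The registered STUBS below restate them verbatim over tree vocabulary; `Registered.stub_*` are the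
reducible aliases under the stubs' names that the skeleton audit admits as hypotheses of
`PenaltyUniversality_of` — it accepts only hypotheses whose head constant is named like a declared stub.) -/

/-- **FixedFugacityUniversality** (piece A, the SAW end of the flow): for every Dobrushin domain,
endpoint approximation, bounded continuous `f`, every `t₀ < 1` and `ε > 0`, eventually along `δ → 0⁺`,
`|∫ f dBL_t - ∫ f dBL_0| < ε` for all `t ∈ [0, t₀]` (`BL_0 = SAW.law` pushed to curves,
`BlobTime.domainLaw_zero`). -/
def FixedFugacityUniversality : Prop :=
  ∀ (D : Literature.Probability.RandomPlanarGeometry.DobrushinDomain)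
      (a b : ℝ → Literature.Probability.LatticeModels.Site 2),
      Literature.Probability.RandomPlanarGeometry.SAW.IsEndpointApprox D a b →
      ∀ (f : BoundedContinuousFunction (Literature.Probability.RandomPlanarGeometry.CurveClass ℂ) ℝ)
        (t₀ : ℝ), t₀ < 1 → ∀ ε : ℝ, 0 < ε →
        ∀ᶠ δ in nhdsWithin (0 : ℝ) (Set.Ioi 0), ∀ t ∈ Set.Icc (0 : ℝ) t₀,
          |(∫ x, f x ∂(Literature.Probability.RandomPlanarGeometry.BlobTime.domainLaw t D.carrier δ
              (a δ) (b δ))) -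
            ∫ x, f x ∂(Literature.Probability.RandomPlanarGeometry.BlobTime.domainLaw 0 D.carrier δ
              (a δ) (b δ))| < ε

/-- **WindowPlateau** (piece B, the near-Brownian end of the flow; schedule comparison): for every
Dobrushin domain, endpoint approximation, bounded continuous `f` and `ε > 0` there are a fixed fugacity
`t₀ ∈ [0, 1)` and a window constant `M` such that, eventually along `δ → 0⁺`,
`|∫ f dBL_t - ∫ f dBL_{t₀}| < ε` for all `t ∈ [t₀, exp (-M δ^{3/4})]`. -/
def WindowPlateau : Prop :=
  ∀ (D : Literature.Probability.RandomPlanarGeometry.DobrushinDomain)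
      (a b : ℝ → Literature.Probability.LatticeModels.Site 2),
      Literature.Probability.RandomPlanarGeometry.SAW.IsEndpointApprox D a b →
      ∀ (f : BoundedContinuousFunction (Literature.Probability.RandomPlanarGeometry.CurveClass ℂ) ℝ)
        (ε : ℝ), 0 < ε →
        ∃ t₀ ∈ Set.Ico (0 : ℝ) 1, ∃ M : ℝ, ∀ᶠ δ in nhdsWithin (0 : ℝ) (Set.Ioi 0),
          ∀ t ∈ Set.Icc t₀ (Real.exp (-(M * δ ^ (3 / 4 : ℝ)))),
            |(∫ x, f x ∂(Literature.Probability.RandomPlanarGeometry.BlobTime.domainLaw t D.carrier δ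
                (a δ) (b δ))) -
              ∫ x, f x ∂(Literature.Probability.RandomPlanarGeometry.BlobTime.domainLaw t₀ D.carrier δ
                (a δ) (b δ))| < ε

/-! ### The stubs (the ONLY `sorry`s of the file; verbatim restatements of the two pieces) -/

/-- **Stub A = `FixedFugacityUniversality`, verbatim** (fixed-fugacity universality, uniform on compact
fugacity ranges `[0, t₀]`, `t₀ < 1`: the SAW end of the flow). -/
theorem stub_fixedFugacityUniversality :
    ∀ (D : Literature.Probability.RandomPlanarGeometry.DobrushinDomain)
      (a b : ℝ → Literature.Probability.LatticeModels.Site 2),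
      Literature.Probability.RandomPlanarGeometry.SAW.IsEndpointApprox D a b →
      ∀ (f : BoundedContinuousFunction (Literature.Probability.RandomPlanarGeometry.CurveClass ℂ) ℝ)
        (t₀ : ℝ), t₀ < 1 → ∀ ε : ℝ, 0 < ε →
        ∀ᶠ δ in nhdsWithin (0 : ℝ) (Set.Ioi 0), ∀ t ∈ Set.Icc (0 : ℝ) t₀,
          |(∫ x, f x ∂(Literature.Probability.RandomPlanarGeometry.BlobTime.domainLaw t D.carrier δ
              (a δ) (b δ))) -
            ∫ x, f x ∂(Literature.Probability.RandomPlanarGeometry.BlobTime.domainLaw 0 D.carrier δ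
              (a δ) (b δ))| < ε := by
  sorry

/-- **Stub B = `WindowPlateau`, verbatim** (the window plateau `[t₀, exp (-M δ^{3/4})]`: the
near-Brownian end of the flow; schedule comparison). -/
theorem stub_windowPlateau :
    ∀ (D : Literature.Probability.RandomPlanarGeometry.DobrushinDomain)
      (a b : ℝ → Literature.Probability.LatticeModels.Site 2),
      Literature.Probability.RandomPlanarGeometry.SAW.IsEndpointApprox D a b →
      ∀ (f : BoundedContinuousFunction (Literature.Probability.RandomPlanarGeometry.CurveClass ℂ) ℝ)
        (ε : ℝ), 0 < ε →
        ∃ t₀ ∈ Set.Ico (0 : ℝ) 1, ∃ M : ℝ, ∀ᶠ δ in nhdsWithin (0 : ℝ) (Set.Ioi 0),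
          ∀ t ∈ Set.Icc t₀ (Real.exp (-(M * δ ^ (3 / 4 : ℝ)))),
            |(∫ x, f x ∂(Literature.Probability.RandomPlanarGeometry.BlobTime.domainLaw t D.carrier δ
                (a δ) (b δ))) -
              ∫ x, f x ∂(Literature.Probability.RandomPlanarGeometry.BlobTime.domainLaw t₀ D.carrier δ
                (a δ) (b δ))| < ε := by
  sorry

/-! ### Registered names of the stub statements (reducible aliases, for the skeleton audit) -/
namespace Registered

/-- `FixedFugacityUniversality`, under the name of its stub. -/
abbrev stub_fixedFugacityUniversality : Prop := FixedFugacityUniversality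
/-- `WindowPlateau`, under the name of its stub. -/
abbrev stub_windowPlateau : Prop := WindowPlateau

end Registered

/-! ### The composition (sorry-free) -/

/-- **Regime gluing** (abstract real analysis, the heart of the composition).  If a two-parameter
family `Φ δ t` is, eventually in `δ`, `ε`-flat against `t = 0` on every compact fugacity range
`[0, t₀]`, `t₀ < 1` (regime A), and `ε`-flat against some `t₀ ∈ [0, 1)` on a plateau
`[t₀, exp (-M δ^{3/4})]` (regime B), then `Φ δ (t δ) - Φ δ 0 → 0` along `δ → 0⁺` for every schedule
`t` that is eventually non-negative and eventually below every window `exp (-M δ^{3/4})`. -/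
theorem tendsto_sub_of_regimes {Φ : ℝ → ℝ → ℝ} {t : ℝ → ℝ}
    (hA : ∀ t₀ : ℝ, t₀ < 1 → ∀ ε : ℝ, 0 < ε → ∀ᶠ δ in nhdsWithin (0 : ℝ) (Set.Ioi 0),
      ∀ s ∈ Set.Icc (0 : ℝ) t₀, |Φ δ s - Φ δ 0| < ε)
    (hB : ∀ ε : ℝ, 0 < ε → ∃ t₀ ∈ Set.Ico (0 : ℝ) 1, ∃ M : ℝ,
      ∀ᶠ δ in nhdsWithin (0 : ℝ) (Set.Ioi 0),
        ∀ s ∈ Set.Icc t₀ (Real.exp (-(M * δ ^ (3 / 4 : ℝ)))), |Φ δ s - Φ δ t₀| < ε)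
    (h0 : ∀ᶠ δ in nhdsWithin (0 : ℝ) (Set.Ioi 0), 0 ≤ t δ)
    (hM : ∀ M : ℝ, ∀ᶠ δ in nhdsWithin (0 : ℝ) (Set.Ioi 0), t δ ≤ Real.exp (-(M * δ ^ (3 / 4 : ℝ)))) :
    Tendsto (fun δ => Φ δ (t δ) - Φ δ 0) (nhdsWithin (0 : ℝ) (Set.Ioi 0)) (𝓝 0) := by
  rw [Metric.tendsto_nhds]
  intro ε hε
  obtain ⟨t₀, ⟨ht₀0, ht₀1⟩, M, hBev⟩ := hB (ε / 2) (half_pos hε)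
  have hAev := hA t₀ ht₀1 (ε / 2) (half_pos hε)
  filter_upwards [hAev, hBev, h0, hM M] with δ hAδ hBδ h0δ hMδ
  rw [Real.dist_eq, sub_zero]
  by_cases hle : t δ ≤ t₀
  · exact (hAδ (t δ) ⟨h0δ, hle⟩).trans (half_lt_self hε)
  · have h1 : |Φ δ (t δ) - Φ δ t₀| < ε / 2 := hBδ (t δ) ⟨(not_le.mp hle).le, hMδ⟩
    have h2 : |Φ δ t₀ - Φ δ 0| < ε / 2 := hAδ t₀ ⟨ht₀0, le_rfl⟩
    calc |Φ δ (t δ) - Φ δ 0| = |(Φ δ (t δ) - Φ δ t₀) + (Φ δ t₀ - Φ δ 0)| := by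
            rw [sub_add_sub_cancel]
      _ ≤ |Φ δ (t δ) - Φ δ t₀| + |Φ δ t₀ - Φ δ 0| := abs_add_le _ _
      _ < ε / 2 + ε / 2 := add_lt_add h1 h2
      _ = ε := add_halves ε

/-- **The crux in the vocabulary of the named law** (`Iff.rfl`: the item's inlined measure is
`BlobTime.domainLaw (tᵢ δ) D.carrier δ (a δ) (b δ)` by `BlobTime.domainLaw_eq`). -/
theorem penaltyUniversality_iff :
    Summit.CriticalPhenomena.SAWScalingLimit.Theses.SAWCutPointCondensation.PenaltyUniversality ↔
      ∀ (D : DobrushinDomain) (a b : ℝ → Site 2), SAW.IsEndpointApprox D a b →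
        ∀ t₁ t₂ : ℝ → ℝ,
          (∀ᶠ δ in nhdsWithin (0 : ℝ) (Set.Ioi 0), t₁ δ ∈ Set.Icc (0 : ℝ) 1 ∧ t₂ δ ∈ Set.Icc (0 : ℝ) 1) →
          (∀ M : ℝ, ∀ᶠ δ in nhdsWithin (0 : ℝ) (Set.Ioi 0), t₁ δ ≤ Real.exp (-(M * δ ^ (3 / 4 : ℝ)))) →
          (∀ M : ℝ, ∀ᶠ δ in nhdsWithin (0 : ℝ) (Set.Ioi 0), t₂ δ ≤ Real.exp (-(M * δ ^ (3 / 4 : ℝ)))) →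
          ∀ f : BoundedContinuousFunction (CurveClass ℂ) ℝ,
            Tendsto (fun δ => (∫ x, f x ∂(BlobTime.domainLaw (t₁ δ) D.carrier δ (a δ) (b δ))) -
                ∫ x, f x ∂(BlobTime.domainLaw (t₂ δ) D.carrier δ (a δ) (b δ)))
              (nhdsWithin (0 : ℝ) (Set.Ioi 0)) (𝓝 0) :=
  Iff.rfl

/-- **`PenaltyUniversality` from the line `birth`** (kernel-checked, no `sorry` of its own): the
fixed-fugacity regime (stub A) and the window plateau (stub B) glue along the fugacity axis
(`tendsto_sub_of_regimes`) to `∫ f dBL_{t δ} - ∫ f dBL_0 → 0` for every admissible schedule `t`; the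
crux is the difference of the two schedules' limits.  Hypotheses = the two stubs, under their registered
names (`Registered.stub_*`, reducible aliases of `FixedFugacityUniversality` / `WindowPlateau`, whose
texts are the stub signatures verbatim — certified definitionally by `PenaltyUniversality_proof`). -/
theorem PenaltyUniversality_of (hA : Registered.stub_fixedFugacityUniversality)
    (hB : Registered.stub_windowPlateau) :
    Summit.CriticalPhenomena.SAWScalingLimit.Theses.SAWCutPointCondensation.PenaltyUniversality := by
  dsimp only [Registered.stub_fixedFugacityUniversality, FixedFugacityUniversality,
    Registered.stub_windowPlateau, WindowPlateau] at hA hB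
  rw [penaltyUniversality_iff]
  intro D a b hab t₁ t₂ h01 hM1 hM2 f
  -- each admissible schedule is asymptotically equal in law to the SAW end `t = 0`
  have key : ∀ t : ℝ → ℝ, (∀ᶠ δ in nhdsWithin (0 : ℝ) (Set.Ioi 0), 0 ≤ t δ) →
      (∀ M : ℝ, ∀ᶠ δ in nhdsWithin (0 : ℝ) (Set.Ioi 0),
        t δ ≤ Real.exp (-(M * δ ^ (3 / 4 : ℝ)))) →
      Tendsto (fun δ => (∫ x, f x ∂(BlobTime.domainLaw (t δ) D.carrier δ (a δ) (b δ))) -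
          ∫ x, f x ∂(BlobTime.domainLaw 0 D.carrier δ (a δ) (b δ)))
        (nhdsWithin (0 : ℝ) (Set.Ioi 0)) (𝓝 0) :=
    fun t h0 hM =>
      tendsto_sub_of_regimes
        (Φ := fun δ s => ∫ x, f x ∂(BlobTime.domainLaw s D.carrier δ (a δ) (b δ))) (t := t)
        (fun t₀ ht₀ ε hε => hA D a b hab f t₀ ht₀ ε hε) (fun ε hε => hB D a b hab f ε hε) h0 hM
  have h := (key t₁ (h01.mono fun δ hδ => hδ.1.1) hM1).sub (key t₂ (h01.mono fun δ hδ => hδ.2.1) hM2)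
  rw [sub_zero] at h
  refine h.congr fun δ => ?_
  ring

/-- Wiring check: the registered stubs feed the composition as stated (this term becomes the crux
proof when the two `sorry`s above are discharged). -/
theorem PenaltyUniversality_proof :
    Summit.CriticalPhenomena.SAWScalingLimit.Theses.SAWCutPointCondensation.PenaltyUniversality :=
  PenaltyUniversality_of stub_fixedFugacityUniversality stub_windowPlateau

end Summit.CriticalPhenomena.SAWScalingLimit.Cruxes.PenaltyUniversality.Birth

end
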